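/-
Copyright (c) 2026. All rights reserved.
Released under Apache 2.0 license as described in the file LICENSE.
Authors: abc-iut cell, campaign-S prover seat abc-iut-S8 (wave 2).
-/
import Literature.IUT.LogVolume.LogVolumeEstimates
import Literature.IUT.LogVolume.TensorPacketBridge
import Literature.IUT.LogVolume.TensorPacketLattice
import Literature.IUT.LogVolume.TensorPacketScaling
import Literature.IUT.LogVolume.LogShellTopology
import HarnessLib

/-!
# [IUTchIV] Prop. 1.4 (iii), first displayed inequality — proved

Mochizuki, *Inter-universal Teichmüller theory IV*, RIMS manuscript (Apr. 2020), §1, Prop. 1.4 (iii),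
kurims p. 13: "`μ^log(p^{⌊λ−d_I−a_I⌋}·log_p(R_I^×)) ≤ {−λ + d_I + 1 + 4·|I*|/p}·log(p)`".
`LogVolumeEstimates.Prop14iii₁_of_logPacket_volume` (abc-iut-S8) reduced this to three facts about the
log-volume of `log_p(R_I^×) ⊆ V = ⊗ k_i`; they are supplied by abc-iut-S7's intrinsic Haar measure on
`V`: the bridge `packetLogVolume ψ = tensorLogVolume` (`TensorPacketBridge`), the scaling
`μ^log(p^n·A) = μ^log(A) − n·log p` (`TensorPacketScaling.tensorLogVolume_ppow_smul`), the identity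
"`μ^log(log_p(R_I^×)) = Σ_{i∈I} μ^log(log_p(R_i^×)) + μ^log(R_I)`" (`TensorPacketLattice.
tensorLogVolume_packetOf`, volumes of tensor products of lattices) and "`μ^log(R_I) ≤ μ^log((R_I)^∼) = 0`"
(`tensorLogVolume_integerPacket_nonpos`), together with `e_i·f_i = [k_i : ℚ_p]`
(`FundamentalIdentity`, abc-iut-S1).  Result: `Prop14iii₁_holds`.  Nothing here bears on the disputed
[IUTchIII] Cor. 3.12.
-/

noncomputable section

open MeasureTheory Set Metric
open scoped NormedField Pointwise ENNReal

namespace Literature.IUT.LogVolume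

variable (p : ℕ) [Fact p.Prime]
variable {I : Type} [Fintype I] [DecidableEq I]
variable (k : I → Type) [∀ i, NontriviallyNormedField (k i)] [∀ i, NormedAlgebra ℚ_[p] (k i)]
  [∀ i, IsUltrametricDist (k i)] [∀ i, ProperSpace (k i)]
variable {J : Type} [Fintype J] (L : J → Type) [∀ j, NontriviallyNormedField (L j)]
  [∀ j, NormedAlgebra ℚ_[p] (L j)] [∀ j, IsUltrametricDist (L j)] [∀ j, ProperSpace (L j)]
  [∀ j, MeasurableSpace (L j)] [∀ j, BorelSpace (L j)]
variable (ψ : PacketAlgebra p k ≃ₐ[ℚ_[p]] (Π j, L j))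

/-- **[IUTchIV] Prop. 1.4 (iii), first displayed inequality, holds** for the log-volume through any
decomposition `ψ` (equivalently, by the bridge, for the intrinsic log-volume of `V`).
[cite: Mochizuki2012, IUTchIV Prop. 1.4 (iii) p. 13] -/
theorem Prop14iii₁_holds : Prop14iii₁ p k L ψ := by
  intro hI Istar htame i m
  haveI : Nonempty I := Fintype.card_pos_iff.mp (by omega)
  -- the per-factor volumes of the printed proof live on the Borel σ-algebras of the `k_i`
  letI : ∀ i, MeasurableSpace (k i) := fun i ↦ borel (k i)
  haveI : ∀ i, BorelSpace (k i) := fun i ↦ ⟨rfl⟩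
  have hp : p.Prime := Fact.out
  set Λ := integerStructure p k with hΛ
  -- `log_p(R_I^×) = ⊗ log_p(R_i^×)` is a compact open subgroup of `V`
  have hMo : ∀ i, IsOpen ((logUnitsAddSubgroup p (k i) : AddSubgroup (k i)) : Set (k i)) :=
    fun i ↦ isOpen_logUnits p (k i)
  have hMc : ∀ i, IsCompact ((logUnitsAddSubgroup p (k i) : AddSubgroup (k i)) : Set (k i)) :=
    fun i ↦ isCompact_logUnits p (k i)
  have hLpos : 0 < Λ.haar (logPacket p k : Set (PacketAlgebra p k)) := by
    rw [logPacket_eq_packetOf]; exact haar_packetOf_pos p k _ hMo hMc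
  have hLfin : Λ.haar (logPacket p k : Set (PacketAlgebra p k)) < ∞ := by
    rw [logPacket_eq_packetOf]; exact haar_packetOf_lt_top p k _ hMo hMc
  have hRpos : 0 < Λ.haar (integerPacket p k : Set (PacketAlgebra p k)) := by
    rw [hΛ, ← coe_integerStructure, IntegralStructure.haar_self]; exact one_pos
  have hRfin : Λ.haar (integerPacket p k : Set (PacketAlgebra p k)) < ∞ := by
    rw [hΛ, ← coe_integerStructure, IntegralStructure.haar_self]; exact ENNReal.one_lt_top
  -- translates `p^n · log_p(R_I^×)` keep positive finite volume
  have hT : ∀ n : ℤ, 0 < Λ.haar (ppow p k n • (logPacket p k : Set (PacketAlgebra p k))) ∧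
      Λ.haar (ppow p k n • (logPacket p k : Set (PacketAlgebra p k))) < ∞ := by
    intro n
    have hp0 : (p : ℚ_[p]) ≠ 0 := Nat.cast_ne_zero.mpr hp.ne_zero
    obtain ⟨u, hu⟩ := (IsUnit.mk0 _ (zpow_ne_zero n hp0)).map (algebraMap ℚ_[p] (PacketAlgebra p k))
    have hset : ppow p k n • (logPacket p k : Set (PacketAlgebra p k))
        = packetMulLeftEquiv p k u '' (logPacket p k : Set (PacketAlgebra p k)) := by
      rw [packetMulLeftEquiv_image, ppow, ← hu]
      rfl
    rw [hset, Λ.haar_image]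
    exact ⟨ENNReal.mul_pos (Λ.haar_image_self_pos _).ne' hLpos.ne',
      ENNReal.mul_lt_top (Λ.haar_image_self_lt_top _) hLfin⟩
  refine Prop14iii₁_of_logPacket_volume p k L ψ ?_ ?_ ?_ hI Istar htame i m
  · intro n
    obtain ⟨hpos, hfin⟩ := hT n
    rw [packetLogVolume_eq_tensorLogVolume p k L ψ hpos hfin,
      packetLogVolume_eq_tensorLogVolume p k L ψ hLpos hLfin, tensorLogVolume_ppow_smul p k n hLpos hLfin]
    ring
  · rw [packetLogVolume_eq_tensorLogVolume p k L ψ hLpos hLfin,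
      packetLogVolume_eq_tensorLogVolume p k L ψ hRpos hRfin]
    have h := tensorLogVolume_packetOf p k (fun i ↦ logUnitsAddSubgroup p (k i)) hMo hMc
    rw [← logPacket_eq_packetOf] at h
    rw [h]
    congr 1
    refine Finset.sum_congr rfl fun i _ ↦ ?_
    rw [absRamificationIdx_mul_residueDegree p (k i), coe_logUnitsAddSubgroup]
  · rw [packetLogVolume_eq_tensorLogVolume p k L ψ hRpos hRfin]
    exact tensorLogVolume_integerPacket_nonpos p k (isCompact_normalizedPacket_of_decomposition p k L ψ)

end Literature.IUT.LogVolume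

end
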